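import Summits.Ventures.CertifiedQuantumChemistry.Rows.TableDistanceTransport
import HarnessLib

/-!
# Ventures/CertifiedQuantumChemistry — Rows/TableDistanceLipschitz.lean: PROOF of the table-level Lipschitz
# bound (E2) = (S2) ∧ (S3) stated OPEN in `Rows/TableDistanceTransport.lean`, and the now-UNCONDITIONAL row transports

HONEST FRAMING (verbatim): certified bounds for a stated model Hamiltonian in a stated basis; not a
claim about the real molecule or material beyond that model. This file certifies NO number: it PROVES
the three `Prop`s typed open in `Rows/TableDistanceTransport.lean` (wave-4 LINE #1 «M3 × M5», (E2)/(S2)/(S3);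
director-chem P13 (3)/(4); chem-idea-13 g3 INBOX l.6210 (m4) «EnergyTableLipschitz is TYPED, not yet proved»):

* §1 (S2) `Model.sectorEnergyOpNormLipschitz_holds : Model.SectorEnergyOpNormLipschitz` — WEYL FOR THE SECTOR
  MINIMUM in l2-OPERATOR norm: `|E₀(H; a, b) − E₀(H′; a, b)| ≤ ‖H − H′‖` for ANY two matrices on the Fock space
  and a physical sector (`abs_minEnergyOn_sub_le_opNorm`, `abs_sectorGroundEnergy_sub_le_opNorm`; the pointwise
  input is `|Re⟨ψ, Dψ⟩| ≤ ‖D‖` for unit `ψ`, Cauchy–Schwarz + `‖Dψ‖₂ ≤ ‖D‖‖ψ‖₂`). No Hermiticity is used.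
* §2 (S3) `Model.opNormTableBound_holds : Model.OpNormTableBound` — `‖Ĥ_F − Ĥ_G‖ ≤ ε_rd(F, G)` from
  `‖E_pq‖ ≤ 2` (local), `‖e_pqrs‖ ≤ 4` (`‖a†‖, ‖a‖ ≤ 1`, `norm_creation_le_one` / `norm_annihilation_le_one`), `‖1‖ ≤ 1`
  and the triangle inequality on `molecularHamiltonian` (`norm_molecularHamiltonian_le`), applied to the pencil
  file `F − G` (`Model.hamiltonian_pencil`).
* §3 (E2) `Model.energyTableLipschitz_holds : Model.EnergyTableLipschitz` (`Model.energyTableLipschitz_of`), and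
  the transports of `Rows/TableDistanceTransport.lean` §2–§3 with the `(hE2 : …)` hypothesis DISCHARGED
  (`LowerRow.of_tableDist'`, `UpperRow.of_tableDist'`, `lowerRow_of_exactRotation_round'`,
  `upperRow_of_exactRotation_round'`, `lowerRow_levelShift_of_exactRotation_round'`) — the shapes a Lean cell of a
  «F″ = round(rotate u F)» certificate row (STEP-2) instantiates with no open hypothesis left.

WHAT THIS IS NOT: not a certificate; not a row; no census move; no new definition (theorems only, standard
axioms); typed AND proved by chem-type-07 (B8-1 slot 07, gen 13) in an idle hour, as the chair's routing
allowed («the Prop's proof is the LINE's later business unless a typer is idle»).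

References: R. A. Horn, C. R. Johnson, *Matrix Analysis* (2nd ed. 2013) Thm 4.3.1 (Weyl) and §5.6 (the
spectral norm is an operator norm); T. Helgaker, P. Jørgensen, J. Olsen, *Molecular Electronic-Structure
Theory* (2000) eq. (2.2.18) (the second-quantised Hamiltonian); T. Koma, H. Tasaki, PRL 68 (1992) 3248,
after eq. (11) (`‖c†‖, ‖c‖ ≤ 1`). Tree (REUSED, nothing re-declared): `Matrix.minEnergyOn`,
`sectorGroundEnergy(_def)`, `exists_unit_isInSector`, `mem_szSector_iff_isInSector`, `eucNorm_eq_one`,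
`norm_star_dotProduct_le_eucNorm`, `eucNorm_mulVec_le`, `norm_creation_le_one`, `norm_annihilation_le_one`,
`molecularHamiltonian`, `singletExcitation`, `twoElectronExcitation`, `Model.hamiltonian_pencil`,
`Model.tableDist`, `Model.energyTableLipschitz_of`, the §2–§3 transports. Mathlib: `Matrix.l2_opNorm_diagonal`,
`Complex.abs_re_le_norm`, `norm_sum_le`, `norm_smul`, `norm_mul_le`, `le_csInf`, `csInf_le`.
-/

noncomputable section

namespace Summit.Ventures.CertifiedQuantumChemistry

open Matrix Finset
open Literature.MathematicalPhysics.QuantumLattice Literature.MathematicalPhysics.QuantumChemistry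
open scoped Matrix.Norms.L2Operator ComplexOrder

/-! ## §1 (S2) Weyl for the sector minimum in operator norm -/

section S2

variable {n : Type*} [Fintype n] [DecidableEq n]

/-- `|Re⟨ψ, Dψ⟩| ≤ ‖D‖` (l2 operator norm) for a unit vector `ψ`: Cauchy–Schwarz and `‖Dψ‖₂ ≤ ‖D‖·‖ψ‖₂`.
[cite: HornJohnson2013, §5.6] -/
theorem abs_re_expect_le_opNorm {ψ : n → ℂ} (hψ1 : star ψ ⬝ᵥ ψ = 1) (D : Matrix n n ℂ) :
    |(star ψ ⬝ᵥ D *ᵥ ψ).re| ≤ ‖D‖ := by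
  refine (Complex.abs_re_le_norm _).trans ((norm_star_dotProduct_le_eucNorm hψ1 _).trans ?_)
  have h := eucNorm_mulVec_le D ψ
  rwa [eucNorm_eq_one hψ1, mul_one] at h

/-- The Rayleigh quotients of `M` on the unit vectors of a subspace are bounded below by `−‖M‖`. -/
private theorem bddBelow_rayleighSet_opNorm (M : Matrix n n ℂ) (K : Submodule ℂ (n → ℂ)) :
    BddBelow {E : ℝ | ∃ ψ ∈ K, star ψ ⬝ᵥ ψ = 1 ∧ E = (star ψ ⬝ᵥ M *ᵥ ψ).re} := by
  refine ⟨-‖M‖, ?_⟩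
  rintro E ⟨ψ, -, hψ1, rfl⟩
  exact (abs_le.1 (abs_re_expect_le_opNorm hψ1 M)).1

/-- **The variational minimum over a fixed subspace is 1-Lipschitz in the operator (l2 operator norm)**:
`|minEnergyOn H K − minEnergyOn H′ K| ≤ ‖H − H′‖` for any subspace `K` carrying a unit vector — the op-norm
sharpening of the tree's entry-sum `abs_minEnergyOn_sub_le`. [cite: HornJohnson2013, Thm 4.3.1] -/
theorem abs_minEnergyOn_sub_le_opNorm (H H' : Matrix n n ℂ) (K : Submodule ℂ (n → ℂ))
    (hK : ∃ ψ ∈ K, star ψ ⬝ᵥ ψ = 1) :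
    |H.minEnergyOn K - H'.minEnergyOn K| ≤ ‖H - H'‖ := by
  unfold Matrix.minEnergyOn
  set B := ‖H - H'‖
  have hne : ∀ M : Matrix n n ℂ,
      {E : ℝ | ∃ ψ ∈ K, star ψ ⬝ᵥ ψ = 1 ∧ E = (star ψ ⬝ᵥ M *ᵥ ψ).re}.Nonempty := fun M => by
    obtain ⟨ψ, hψK, hψ1⟩ := hK
    exact ⟨_, ψ, hψK, hψ1, rfl⟩
  -- pointwise: `|Re⟨ψ,Hψ⟩ − Re⟨ψ,H'ψ⟩| ≤ B`
  have hpt : ∀ ψ : n → ℂ, star ψ ⬝ᵥ ψ = 1 →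
      |(star ψ ⬝ᵥ H *ᵥ ψ).re - (star ψ ⬝ᵥ H' *ᵥ ψ).re| ≤ B := by
    intro ψ hψ1
    have hsub : (star ψ ⬝ᵥ H *ᵥ ψ).re - (star ψ ⬝ᵥ H' *ᵥ ψ).re = (star ψ ⬝ᵥ (H - H') *ᵥ ψ).re := by
      rw [Matrix.sub_mulVec, dotProduct_sub, Complex.sub_re]
    rw [hsub]
    exact abs_re_expect_le_opNorm hψ1 (H - H')
  rw [abs_sub_le_iff]
  constructor
  · rw [sub_le_iff_le_add]
    have : sInf {E : ℝ | ∃ ψ ∈ K, star ψ ⬝ᵥ ψ = 1 ∧ E = (star ψ ⬝ᵥ H *ᵥ ψ).re} - B ≤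
        sInf {E : ℝ | ∃ ψ ∈ K, star ψ ⬝ᵥ ψ = 1 ∧ E = (star ψ ⬝ᵥ H' *ᵥ ψ).re} := by
      refine le_csInf (hne _) ?_
      rintro E ⟨ψ, hψK, hψ1, rfl⟩
      have h1 := csInf_le (bddBelow_rayleighSet_opNorm H K) ⟨ψ, hψK, hψ1, rfl⟩
      have h2 := (abs_sub_le_iff.1 (hpt ψ hψ1)).1
      linarith
    linarith
  · rw [sub_le_iff_le_add]
    have : sInf {E : ℝ | ∃ ψ ∈ K, star ψ ⬝ᵥ ψ = 1 ∧ E = (star ψ ⬝ᵥ H' *ᵥ ψ).re} - B ≤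
        sInf {E : ℝ | ∃ ψ ∈ K, star ψ ⬝ᵥ ψ = 1 ∧ E = (star ψ ⬝ᵥ H *ᵥ ψ).re} := by
      refine le_csInf (hne _) ?_
      rintro E ⟨ψ, hψK, hψ1, rfl⟩
      have h1 := csInf_le (bddBelow_rayleighSet_opNorm H' K) ⟨ψ, hψK, hψ1, rfl⟩
      have h2 := (abs_sub_le_iff.1 (hpt ψ hψ1)).2
      linarith
    linarith

end S2

section S2Sector

variable {Λ : Type*} [LinearOrder Λ] [Fintype Λ]

/-- **(S2) `E₀` is 1-Lipschitz in the operator norm**: `|E₀(H; a, b) − E₀(H′; a, b)| ≤ ‖H − H′‖` for any two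
matrices on the Fock space of the orbital set `Λ` and a physical sector `a, b ≤ |Λ|` (the sector carries the unit
vector `|α↑ ∪ β↓⟩`, `exists_unit_isInSector`). [cite: HornJohnson2013, Thm 4.3.1] -/
theorem abs_sectorGroundEnergy_sub_le_opNorm (H H' : Matrix (Finset (Orb Λ)) (Finset (Orb Λ)) ℂ) {a b : ℕ}
    (ha : a ≤ Fintype.card Λ) (hb : b ≤ Fintype.card Λ) :
    |sectorGroundEnergy H a b - sectorGroundEnergy H' a b| ≤ ‖H - H'‖ := by
  rw [sectorGroundEnergy_def, sectorGroundEnergy_def]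
  obtain ⟨ψ, hψ, hψ1⟩ := exists_unit_isInSector (Λ := Λ) ha hb
  exact abs_minEnergyOn_sub_le_opNorm H H' _ ⟨ψ, (mem_szSector_iff_isInSector a b ψ).2 hψ, hψ1⟩

end S2Sector

/-- **(S2) DISCHARGED**: the open statement `Model.SectorEnergyOpNormLipschitz` of `Rows/TableDistanceTransport.lean`
holds. [cite: HornJohnson2013, Thm 4.3.1] -/
theorem Model.sectorEnergyOpNormLipschitz_holds : Model.SectorEnergyOpNormLipschitz := by
  intro k H H' a b ha hb
  exact abs_sectorGroundEnergy_sub_le_opNorm H H' (by rwa [Fintype.card_fin]) (by rwa [Fintype.card_fin])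

/-! ## §2 (S3) The ℓ¹ operator-norm control of the second-quantised map -/

section S3

variable {Λ : Type*} [LinearOrder Λ] [Fintype Λ]

/-- `‖a†_{i} a_{j}‖ ≤ 1` (each factor has operator norm `≤ 1`). [cite: KomaTasakiPRL1992, after eq. (11)] -/
theorem norm_creation_mul_annihilation_le_one (i j : Orb Λ) :
    ‖(creation i * annihilation j : Matrix (Finset (Orb Λ)) (Finset (Orb Λ)) ℂ)‖ ≤ 1 := by
  refine (norm_mul_le _ _).trans ?_
  have h1 := norm_creation_le_one (ι := Orb Λ) i
  have h2 := norm_annihilation_le_one (ι := Orb Λ) j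
  nlinarith [norm_nonneg (creation i : Matrix (Finset (Orb Λ)) (Finset (Orb Λ)) ℂ),
    norm_nonneg (annihilation j : Matrix (Finset (Orb Λ)) (Finset (Orb Λ)) ℂ)]

/-- `‖a†_{pσ} a†_{rτ} a_{sτ} a_{qσ}‖ ≤ 1`. [cite: KomaTasakiPRL1992, after eq. (11)] -/
theorem norm_twoBodyMonomial_le_one (i j i' j' : Orb Λ) :
    ‖(creation i * creation j * annihilation i' * annihilation j' :
      Matrix (Finset (Orb Λ)) (Finset (Orb Λ)) ℂ)‖ ≤ 1 := by
  have hc := fun l : Orb Λ => norm_creation_le_one (ι := Orb Λ) l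
  have ha := fun l : Orb Λ => norm_annihilation_le_one (ι := Orb Λ) l
  have n0 := fun (M : Matrix (Finset (Orb Λ)) (Finset (Orb Λ)) ℂ) => norm_nonneg M
  have h12 : ‖(creation i * creation j : Matrix (Finset (Orb Λ)) (Finset (Orb Λ)) ℂ)‖ ≤ 1 :=
    (norm_mul_le _ _).trans (by nlinarith [hc i, hc j, n0 (creation i), n0 (creation j)])
  have h123 : ‖(creation i * creation j * annihilation i' : Matrix (Finset (Orb Λ)) (Finset (Orb Λ)) ℂ)‖ ≤ 1 :=
    (norm_mul_le _ _).trans (by nlinarith [h12, ha i', n0 (creation i * creation j), n0 (annihilation i')])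
  exact (norm_mul_le _ _).trans
    (by nlinarith [h123, ha j', n0 (creation i * creation j * annihilation i'), n0 (annihilation j')])

/-- `‖e_pqrs‖ ≤ 4`: the two-electron excitation operator is a sum of four monomials of norm `≤ 1`.
[cite: HelgakerJorgensenOlsen2000, eq. (2.2.16)] -/
theorem norm_twoElectronExcitation_le (p q r s : Λ) :
    ‖(twoElectronExcitation p q r s : Matrix (Finset (Orb Λ)) (Finset (Orb Λ)) ℂ)‖ ≤ 4 := by
  unfold twoElectronExcitation
  refine (norm_sum_le _ _).trans ?_
  calc ∑ σ : Fin 2, ‖∑ τ : Fin 2, (creation (orb p σ) * creation (orb r τ) * annihilation (orb s τ) *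
          annihilation (orb q σ) : Matrix (Finset (Orb Λ)) (Finset (Orb Λ)) ℂ)‖
      ≤ ∑ _σ : Fin 2, ∑ _τ : Fin 2, (1 : ℝ) := Finset.sum_le_sum fun σ _ =>
          (norm_sum_le _ _).trans (Finset.sum_le_sum fun τ _ => norm_twoBodyMonomial_le_one _ _ _ _)
    _ = 4 := by norm_num

/-- `‖1‖ ≤ 1` for the identity matrix in l2 operator norm (`= 1` on a nonempty index type, `0` else). -/
theorem norm_one_fock_le_one : ‖(1 : Matrix (Finset (Orb Λ)) (Finset (Orb Λ)) ℂ)‖ ≤ 1 := by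
  rw [← diagonal_one, l2_opNorm_diagonal, pi_norm_le_iff_of_nonneg zero_le_one]
  intro _
  simp

/-- **The ℓ¹ control of the second-quantised map**: `‖Ĥ(h, g, c)‖ ≤ 2·Σ_pq |h_pq| + 2·Σ_pqrs |g_pqrs| + |c|`
(l2 operator norm on the Fock space; `‖E_pq‖ ≤ 2`, `½·‖e_pqrs‖ ≤ 2`, `‖1‖ ≤ 1`).
[cite: HelgakerJorgensenOlsen2000, eq. (2.2.18)] -/
theorem norm_molecularHamiltonian_le (h : Λ → Λ → ℂ) (g : Λ → Λ → Λ → Λ → ℂ) (c : ℂ) :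
    ‖molecularHamiltonian h g c‖ ≤
      2 * ∑ p, ∑ q, ‖h p q‖ + 2 * ∑ p, ∑ q, ∑ r, ∑ s, ‖g p q r s‖ + ‖c‖ := by
  -- `‖E_pq‖ ≤ 2`: a sum of two monomials of norm `≤ 1` (kept local: the tree's `norm_bondPair_le_two` is the
  -- same estimate for a DIFFERENT operator, the bond pair `b_uv`, and is not reusable here)
  have hE : ∀ p q : Λ, ‖(singletExcitation p q : Matrix (Finset (Orb Λ)) (Finset (Orb Λ)) ℂ)‖ ≤ 2 := by
    intro p q
    unfold singletExcitation
    refine (norm_sum_le _ _).trans ?_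
    calc ∑ σ : Fin 2, ‖(creation (orb p σ) * annihilation (orb q σ) : Matrix (Finset (Orb Λ)) (Finset (Orb Λ)) ℂ)‖
        ≤ ∑ _σ : Fin 2, (1 : ℝ) := Finset.sum_le_sum fun σ _ => norm_creation_mul_annihilation_le_one _ _
      _ = 2 := by norm_num
  unfold molecularHamiltonian
  refine (norm_add_le _ _).trans (add_le_add ((norm_add_le _ _).trans (add_le_add ?_ ?_)) ?_)
  · -- one-body part
    calc ‖∑ p, ∑ q, h p q • (singletExcitation p q : Matrix (Finset (Orb Λ)) (Finset (Orb Λ)) ℂ)‖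
        ≤ ∑ p, ∑ q, ‖h p q‖ * 2 := (norm_sum_le _ _).trans (Finset.sum_le_sum fun p _ =>
            (norm_sum_le _ _).trans (Finset.sum_le_sum fun q _ => by
              rw [norm_smul]
              exact mul_le_mul_of_nonneg_left (hE p q) (norm_nonneg _)))
      _ = 2 * ∑ p, ∑ q, ‖h p q‖ := by
            rw [Finset.mul_sum]
            refine Finset.sum_congr rfl fun p _ => ?_
            rw [Finset.mul_sum]
            exact Finset.sum_congr rfl fun q _ => mul_comm _ _
  · -- two-body part
    rw [norm_smul]
    have hhalf : ‖(1 / 2 : ℂ)‖ = 1 / 2 := by norm_num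
    rw [hhalf]
    calc 1 / 2 * ‖∑ p, ∑ q, ∑ r, ∑ s, g p q r s •
            (twoElectronExcitation p q r s : Matrix (Finset (Orb Λ)) (Finset (Orb Λ)) ℂ)‖
        ≤ 1 / 2 * ∑ p, ∑ q, ∑ r, ∑ s, ‖g p q r s‖ * 4 := by
            refine mul_le_mul_of_nonneg_left ?_ (by norm_num)
            exact (norm_sum_le _ _).trans (Finset.sum_le_sum fun p _ =>
              (norm_sum_le _ _).trans (Finset.sum_le_sum fun q _ =>
                (norm_sum_le _ _).trans (Finset.sum_le_sum fun r _ =>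
                  (norm_sum_le _ _).trans (Finset.sum_le_sum fun s _ => by
                    rw [norm_smul]
                    exact mul_le_mul_of_nonneg_left (norm_twoElectronExcitation_le p q r s) (norm_nonneg _)))))
      _ = 2 * ∑ p, ∑ q, ∑ r, ∑ s, ‖g p q r s‖ := by
            rw [Finset.mul_sum, Finset.mul_sum]
            refine Finset.sum_congr rfl fun p _ => ?_
            rw [Finset.mul_sum, Finset.mul_sum]
            refine Finset.sum_congr rfl fun q _ => ?_
            rw [Finset.mul_sum, Finset.mul_sum]
            refine Finset.sum_congr rfl fun r _ => ?_
            rw [Finset.mul_sum, Finset.mul_sum]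
            exact Finset.sum_congr rfl fun s _ => by ring
  · -- constant part
    rw [norm_smul]
    exact (mul_le_mul_of_nonneg_left norm_one_fock_le_one (norm_nonneg _)).trans_eq (mul_one _)

end S3

variable {k : ℕ}

/-- **`‖Ĥ_F − Ĥ_G‖ ≤ ε_rd(F, G)`** for two model files on the same `k` orbitals: the difference is the second-quantised
map of the pencil file `F − G` (`Model.hamiltonian_pencil`), whose tables are the entrywise differences.
[cite: HelgakerJorgensenOlsen2000, eq. (2.2.18)] -/
theorem Model.norm_hamiltonian_sub_le_tableDist (F G : Model k) :
    ‖F.hamiltonian - G.hamiltonian‖ ≤ ((Model.tableDist F G : ℚ) : ℝ) := by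
  have e : F.hamiltonian - G.hamiltonian = (Model.lincomb 1 (-1) F G).hamiltonian := by
    rw [Model.hamiltonian_pencil, Rat.cast_one, Complex.ofReal_one, one_smul]
  rw [e]
  refine (norm_molecularHamiltonian_le _ _ _).trans (le_of_eq ?_)
  simp only [Model.lincomb_h, Model.lincomb_eri, Model.lincomb_ecore, one_mul, neg_one_mul, ← sub_eq_add_neg,
    Complex.norm_ratCast, Model.tableDist]
  push_cast
  ring

/-- **(S3) DISCHARGED**: the open statement `Model.OpNormTableBound` of `Rows/TableDistanceTransport.lean` holds.
[cite: HelgakerJorgensenOlsen2000, eq. (2.2.18)] -/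
theorem Model.opNormTableBound_holds : Model.OpNormTableBound :=
  fun _ F G => Model.norm_hamiltonian_sub_le_tableDist F G

/-! ## §3 (E2) and the unconditional transports -/

/-- **(E2) DISCHARGED — THE TABLE-LEVEL LIPSCHITZ BOUND**: for every `k`, every two model files `F G : Model k` and
every physical sector `a, b ≤ k`, `|E₀(F; a, b) − E₀(G; a, b)| ≤ ε_rd(F, G)` ((S2) ∘ (S3), `Model.energyTableLipschitz_of`).
[cite: HornJohnson2013, Thm 4.3.1] -/
theorem Model.energyTableLipschitz_holds : Model.EnergyTableLipschitz :=
  Model.energyTableLipschitz_of Model.sectorEnergyOpNormLipschitz_holds Model.opNormTableBound_holds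

/-- The pointwise form of (E2): `|E₀(F; a, b) − E₀(G; a, b)| ≤ ε_rd(F, G)` (`a, b ≤ k`). [cite: HornJohnson2013, Thm 4.3.1] -/
theorem Model.abs_energy_sub_le_tableDist (F G : Model k) {a b : ℕ} (ha : a ≤ k) (hb : b ≤ k) :
    |F.energy a b - G.energy a b| ≤ ((Model.tableDist F G : ℚ) : ℝ) :=
  Model.energyTableLipschitz_holds k F G a b ha hb

/-- **LOWER rows transport across a table distance (unconditional)**: `LowerRow G a b lo`, `tableDist F G ≤ ε` ⇒
`LowerRow F a b (lo − ε)`. -/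
theorem LowerRow.of_tableDist' {F G : Model k} {a b : ℕ} {lo ε : ℚ}
    (h : LowerRow G a b lo) (hd : Model.tableDist F G ≤ ε) : LowerRow F a b (lo - ε) :=
  LowerRow.of_tableDist Model.energyTableLipschitz_holds h hd

/-- **UPPER rows transport across a table distance (unconditional)**: `UpperRow G a b hi`, `tableDist F G ≤ ε` ⇒
`UpperRow F a b (hi + ε)`. -/
theorem UpperRow.of_tableDist' {F G : Model k} {a b : ℕ} {hi ε : ℚ}
    (h : UpperRow G a b hi) (hd : Model.tableDist F G ≤ ε) : UpperRow F a b (hi + ε) :=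
  UpperRow.of_tableDist Model.energyTableLipschitz_holds h hd

/-- **(S) THE DEVICE'S LOWER ROW, unconditional**: an exact orbital rotation `u`, a derived table `F″` with
`tableDist (rotate u F) F″ ≤ ε`, and `LowerRow F″ a b lo` give `LowerRow F a b (lo − ε)` on the census key of `F`.
[cite: HelgakerJorgensenOlsen2000, eq. (3.2.1)] -/
theorem lowerRow_of_exactRotation_round' {u : Matrix (Fin k) (Fin k) ℚ} (hu : Model.IsExactOrbitalRotation u)
    {F F'' : Model k} {a b : ℕ} {lo ε : ℚ}
    (hd : Model.tableDist (Model.rotate u F) F'' ≤ ε) (h : LowerRow F'' a b lo) : LowerRow F a b (lo - ε) :=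
  lowerRow_of_exactRotation_round Model.energyTableLipschitz_holds hu hd h

/-- **(S) THE DEVICE'S UPPER ROW, unconditional**: `UpperRow F″ a b hi`, `tableDist (rotate u F) F″ ≤ ε` ⇒
`UpperRow F a b (hi + ε)`. [cite: HelgakerJorgensenOlsen2000, eq. (3.2.1)] -/
theorem upperRow_of_exactRotation_round' {u : Matrix (Fin k) (Fin k) ℚ} (hu : Model.IsExactOrbitalRotation u)
    {F F'' : Model k} {a b : ℕ} {hi ε : ℚ}
    (hd : Model.tableDist (Model.rotate u F) F'' ≤ ε) (h : UpperRow F'' a b hi) : UpperRow F a b (hi + ε) :=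
  upperRow_of_exactRotation_round Model.energyTableLipschitz_holds hu hd h

/-- **LEVEL-SHIFT LOWER ROW TRANSPORT, unconditional** (S5, «no new β leg»): `rotate u W = W`,
`tableDist (rotate u F) F″ ≤ ε` and the census β leg `LowerRow (lincomb 1 λ F W) a b ℓ` give
`LowerRow (lincomb 1 λ F″ W) a b (ℓ − ε)` on the rounded rotated file. [cite: HelgakerJorgensenOlsen2000, eq. (3.2.1)] -/
theorem lowerRow_levelShift_of_exactRotation_round' {u : Matrix (Fin k) (Fin k) ℚ}
    (hu : Model.IsExactOrbitalRotation u) {F F'' W : Model k} (hW : Model.rotate u W = W) {lam : ℚ} {a b : ℕ}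
    {ℓ ε : ℚ} (hd : Model.tableDist (Model.rotate u F) F'' ≤ ε) (h : LowerRow (Model.lincomb 1 lam F W) a b ℓ) :
    LowerRow (Model.lincomb 1 lam F'' W) a b (ℓ - ε) :=
  lowerRow_levelShift_of_exactRotation_round Model.energyTableLipschitz_holds hu hW hd h

end Summit.Ventures.CertifiedQuantumChemistry

end
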